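import Literature.NumberTheory.ComplexMultiplication.CMTypeUniformizationReductionIdentification
import Literature.NumberTheory.ComplexMultiplication.CMTypeUniformizationTransport
import Literature.AlgebraicGeometry.Motives.AbelianVarietyFrobeniusTwistVariety
import Literature.AlgebraicGeometry.Motives.AbelianVarietyBaseChangeTower
import HarnessLib

/-!
# Glue around the identification step of the proof of the Main Theorem of Complex Multiplication
# (Shimura 1998, Thm. 18.6, proof pp. 128–129: `ψ`, `θ̃ = ψ`, `κ = θ ∘ λ`, `κ̃ = π`)

Topic `NumberTheory/ComplexMultiplication`; namespace `Literature.NumberTheory.ComplexMultiplication` (sub-namespace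
`CMTypeUniformization` for the transport).  THEOREMS and one small transport `def` (`CMTypeUniformization.baseChangeTower`,
an instance of the tree's `CMTypeUniformization.ofIso`); no named fact.  Cell hodgecm-mathlib, fan B, rung B-II, row
II-1 v2 (`b2-main-theorem-cm`), S7-glue around stub S3 (the tree theorem
`CMTypeUniformization.exists_iso_redHom_eq_of_reduction_iso`), PREP `B-provers/B-p15/PREP-S7-glue.md` items G-Ψ,
G-fam, G-κ, G-bc.  HC_CM is proved only modulo the 7 printed citations until rung 0 closes; row II-1 is not one of the
seven binders and nothing here changes that.

## Contents

* §1 (G-Ψ) `comp_trans_symm_hom_eq_of_comm` and `reduction_iso_equivariant_of_pair_of_twist`: the isomorphism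
  `Ψ := ψ ∘ e⁻¹ : Ã_i ≅ (A^γ)~` assembled from the Shimura–Taniyama isomorphism `ψ : Ã_i ≅ Ã^{(q)}` intertwining
  `ι̃_i(a)` with `ι̃(a)^{(q)}` ([Shimura1998] p0167 L1–14, the tree's named fact `shimuraTaniyamaPair`) and the
  identification `e : (A^γ)~ ≅ Ã^{(q)}` intertwining `(ι(a)^γ)~` with `ι̃(a)^{(q)}` («`(Y^σ)~ = Ỹ^f` for every object
  `Y` rational over `L`», p0167 L13; stub S1) is `𝔬`-EQUIVARIANT: `ι̃_i(a) ≫ Ψ = Ψ ≫ (ι(a)^γ)~` — the hypothesis `hΨ`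
  of the identification theorem.
* §2 (G-fam, G-κ) `exists_iso_redHom_eq_of_reduction_iso_family`: the identification theorem for two members of a
  finite FAMILY of abelian varieties over `L` with good reduction at `v` and pair data Tate-compatible along one
  system (the output shape of the named fact `HomReduction.exists_isTateCompatible_family`); and
  `redHom_comp_eq_relFrobenius_comp_inv`: for `κ := λ ≫ θ` with `λ̃ ≫ ψ = π` (relative Frobenius) and `θ̃ = ψ ≫ e⁻¹`,
  the reduction is `κ̃ = π ≫ e⁻¹` («`κ = ι^σ(ε)∘λ` … `κ̃ = π`», [Shimura1998] p0168 L1–3), by functoriality of the pair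
  reductions along a Tate-compatible triple (`HomReduction.redHom_comp_of_isTateCompatible`, §11.1 Prop. 12/14).
* §3 (G-bc) `CMTypeUniformization.baseChangeTower`: a uniformisation of `(A₁ ⊗_{k₁} ℂ, ι₁ ⊗ ℂ)` of type `(K, Φ, 𝔞)`
  is one of `((A₁ ⊗_{k₁} L) ⊗_L ℂ, (ι₁ ⊗ L) ⊗ ℂ)` along the tower isomorphism (moving a model over `k₁` to the common
  field `L ⊇ k₁` of [Shimura1998] p0165 L15, condition (i)), with `baseChangeTower_r`.

NOT here (PREP items left open): G-unif (shape of the uniformisations in `shimuraTaniyamaPair`), G-ξB (the conjugate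
structure is again of type `(K, Φ)`), G-hom (`L`-rationality of homomorphisms), G-conj (`A^γ ⊗ ℂ ≅ (A ⊗ ℂ)^σ`).

## References
* [Shimura1998] G. Shimura, *Abelian Varieties with Complex Multiplication and Modular Functions* (1998), §11.1
  Prop. 12 and Prop. 14 (i) (pp. 83–87); §18.6, proof of Thm. 18.6, pp. 128–129 (held chunks p0165–p0168).
-/

set_option autoImplicit false

noncomputable section

universe u

open CategoryTheory NumberField IsDedekindDomain
open scoped NumberField nonZeroDivisors
open Literature.AlgebraicGeometry.Motives Literature.AlgebraicGeometry.Motives.AbelianVariety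
open Literature.AlgebraicGeometry.Motives.AbelianVariety.GoodReductionAt

namespace Literature.NumberTheory.ComplexMultiplication

/-! ### §1 (G-Ψ). `Ψ := ψ ≫ e⁻¹` is `𝔬`-equivariant -/

section Psi

/-- **Equivariance of `ψ ≫ e⁻¹`**: in any category, if `a ≫ ψ = ψ ≫ c` and `b ≫ e = e ≫ c` for isomorphisms
`ψ : X ≅ Z`, `e : Y ≅ Z`, then `a ≫ (ψ ≫ e⁻¹) = (ψ ≫ e⁻¹) ≫ b` — the bookkeeping behind «`ψ` is an isomorphism of
`(A_i, ι_i)~` to `(A^σ, ι^σ)~`» ([Shimura1998] p0167 L13–14) once `(A^σ)~` is identified with `Ã^f` by `e`.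
[cite: Shimura1998, §18.6 proof of Thm. 18.6, p. 129 (p0167 L13–14)] -/
theorem comp_trans_symm_hom_eq_of_comm {C : Type*} [Category C] {X Y Z : C} (ψ : X ≅ Z) (e : Y ≅ Z)
    {a : X ⟶ X} {b : Y ⟶ Y} {c : Z ⟶ Z} (hψ : a ≫ ψ.hom = ψ.hom ≫ c) (he : b ≫ e.hom = e.hom ≫ c) :
    a ≫ (ψ ≪≫ e.symm).hom = (ψ ≪≫ e.symm).hom ≫ b := by
  have he' : c ≫ e.inv = e.inv ≫ b := by
    rw [Iso.comp_inv_eq, Category.assoc, Iso.eq_inv_comp, he]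
  rw [Iso.trans_hom, Iso.symm_hom, ← Category.assoc, hψ, Category.assoc, he', Category.assoc]

variable {L : Type} [Field L] [NumberField L] {K : Type} [Field K]
  {A B C : AbelianVariety L} {v : HeightOneSpectrum (𝓞 L)}
  {RA : A.GoodReductionAt v} {RB : B.GoodReductionAt v} {RC : C.GoodReductionAt v}

/-- **The reduction isomorphism `Ψ := ψ ≫ e⁻¹ : B̃ ≅ C̃` is `𝔬`-equivariant** — the hypothesis `hΨ` of
`CMTypeUniformization.exists_iso_redHom_eq_of_reduction_iso` — when `ψ : B̃ ≅ Ã^{(q)}` intertwines `ι̃_B(a)` with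
`ι̃_A(a)^{(q)}` (the Shimura–Taniyama isomorphism of the named fact `shimuraTaniyamaPair`, `B = A_i`) and
`e : C̃ ≅ Ã^{(q)}` intertwines `ι̃_C(a)` with `ι̃_A(a)^{(q)}` (the conjugate datum of stub S1, `C = A^γ`,
«`(Y^σ)~ = Ỹ^f`»). [cite: Shimura1998, §18.6 proof of Thm. 18.6, p. 129 (p0167 L1–14)] -/
theorem reduction_iso_equivariant_of_pair_of_twist (ιA : 𝓞 K →+* End A) (ιB : 𝓞 K →+* End B)
    (ιC : 𝓞 K →+* End C) (p n : ℕ) [ExpChar v.asIdeal.ResidueField p]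
    (ψ : RB.reduction ≅ RA.reduction.frobeniusTwist p n)
    (hψ : ∀ a : 𝓞 K, (RB.redEnd (ιB a) : RB.reduction ⟶ RB.reduction) ≫ ψ.hom =
      ψ.hom ≫ Hom.frobeniusTwist p n (RA.redEnd (ιA a) : RA.reduction ⟶ RA.reduction))
    (e : RC.reduction ≅ RA.reduction.frobeniusTwist p n)
    (he : ∀ a : 𝓞 K, (RC.redEnd (ιC a) : RC.reduction ⟶ RC.reduction) ≫ e.hom =
      e.hom ≫ Hom.frobeniusTwist p n (RA.redEnd (ιA a) : RA.reduction ⟶ RA.reduction)) (a : 𝓞 K) :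
    (RB.redEnd (ιB a) : RB.reduction ⟶ RB.reduction) ≫ (ψ ≪≫ e.symm).hom =
      (ψ ≪≫ e.symm).hom ≫ (RC.redEnd (ιC a) : RC.reduction ⟶ RC.reduction) :=
  comp_trans_symm_hom_eq_of_comm ψ e (hψ a) (he a)

end Psi

/-! ### §2 (G-fam, G-κ). The identification inside a Tate-compatible family; `κ̃ = π ≫ e⁻¹` -/

section Family

variable {K : Type} [Field K] [NumberField K] {L : Type} [Field L] [NumberField L] [Algebra L ℂ]

/-- **The identification theorem for two members of a Tate-compatible family.**  For a finite family
`A : J → AbelianVariety L` with good reduction `R j` at `v`, pair data `H j k : Hom(A j, A k) → Hom` of reductions, and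
ONE system of `ℓ`-adic specialisations `T j` with every `H j k` compatible with `(T j, T k)` (`v ∤ ℓ`; the output of
the named fact `HomReduction.exists_isTateCompatible_family`, [Shimura1998] §11.1 Prop. 14 (i) for all the varieties
at once), and indices `i`, `c`: uniformisations of `(A i ⊗ ℂ, ι_i)`, `(A c ⊗ ℂ, ι_c)` of types `(K, Φ; 𝔞)`, `(K, Φ; 𝔟)`,
`L`-rationality of the `ℂ`-homomorphisms both ways, and an `𝔬`-equivariant `Ψ : (A i)~ ≅ (A c)~` give an
`𝔬`-equivariant `θ : A i ≅ A c` over `L` with `(H i c).redHom θ = Ψ` (`exists_iso_redHom_eq_of_reduction_iso` at the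
pair data `H i c`, `H c i`). [cite: Shimura1998, §18.6 Thm. 18.6, proof p0167 L13 – p0168 L3; §11.1 Prop. 12, 14 (i)] -/
theorem CMTypeUniformization.exists_iso_redHom_eq_of_reduction_iso_family {J : Type*} (A : J → AbelianVariety L)
    (i c : J) (Φ : CMType K) (𝔞 𝔟 : (FractionalIdeal (𝓞 K)⁰ K)ˣ)
    (ιA : 𝓞 K →+* End (A i)) (ιB : 𝓞 K →+* End (A c))
    (ξA : CMTypeUniformization Φ 𝔞 ((A i).baseChange ℂ) ((endBaseChange ℂ (A i)).comp ιA))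
    (ξB : CMTypeUniformization Φ 𝔟 ((A c).baseChange ℂ) ((endBaseChange ℂ (A c)).comp ιB))
    (hAB : Function.Surjective (Hom.baseChange ℂ : (A i ⟶ A c) → ((A i).baseChange ℂ ⟶ (A c).baseChange ℂ)))
    (hBA : Function.Surjective (Hom.baseChange ℂ : (A c ⟶ A i) → ((A c).baseChange ℂ ⟶ (A i).baseChange ℂ)))
    (v : HeightOneSpectrum (𝓞 L)) (R : ∀ j, (A j).GoodReductionAt v) (H : ∀ j k, HomReduction (R j) (R k))
    {ℓ : ℕ} [Fact ℓ.Prime] (T : ∀ j, (R j).TateSpecialisation ℓ)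
    (hT : ∀ j k, (H j k).IsTateCompatible (T j) (T k)) (hℓv : (ℓ : 𝓞 L) ∉ v.asIdeal)
    (Ψ : (R i).reduction ≅ (R c).reduction)
    (hΨ : ∀ a : 𝓞 K, ((R i).redEnd (ιA a) : (R i).reduction ⟶ (R i).reduction) ≫ Ψ.hom =
      Ψ.hom ≫ ((R c).redEnd (ιB a) : (R c).reduction ⟶ (R c).reduction)) :
    ∃ θ : A i ≅ A c, (∀ a : 𝓞 K, (ιA a : A i ⟶ A i) ≫ θ.hom = θ.hom ≫ (ιB a : A c ⟶ A c)) ∧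
      (H i c).redHom θ.hom = Ψ.hom :=
  CMTypeUniformization.exists_iso_redHom_eq_of_reduction_iso Φ 𝔞 𝔟 (A i) (A c) ιA ιB ξA ξB hAB hBA v (R i) (R c)
    (H i c) (H c i) (T i) (T c) (hT i c) (hT c i) hℓv Ψ hΨ

omit [Algebra L ℂ] in
/-- **`κ̃ = π ≫ e⁻¹` for `κ := λ ≫ θ`** ([Shimura1998] p0168 L1–3: «put `κ = ι^σ(ε)∘λ` … `κ̃ = π`»): in a
Tate-compatible family with indices `o` (the given `A`), `i` (`A_i`), `c` (`A^γ`), if `λ : A o → A i` reduces to the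
relative Frobenius up to `ψ` (`λ̃ ≫ ψ = π`, the named fact `shimuraTaniyamaPair`) and `θ : A i → A c` reduces to
`ψ ≫ e⁻¹` (the identification theorem), then `κ = λ ≫ θ` reduces to `π ≫ e⁻¹` — functoriality of the pair
reductions along the Tate-compatible triple (`HomReduction.redHom_comp_of_isTateCompatible`, [Shimura1998] §11.1
Prop. 12). [cite: Shimura1998, §18.6 proof of Thm. 18.6, p0168 L1–3; §11.1 Prop. 12] -/
theorem redHom_comp_eq_relFrobenius_comp_inv {J : Type*} {A : J → AbelianVariety L} {o i c : J}
    {v : HeightOneSpectrum (𝓞 L)} {R : ∀ j, (A j).GoodReductionAt v} {H : ∀ j k, HomReduction (R j) (R k)}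
    {ℓ : ℕ} [Fact ℓ.Prime] {T : ∀ j, (R j).TateSpecialisation ℓ}
    (hT : ∀ j k, (H j k).IsTateCompatible (T j) (T k)) (hℓv : (ℓ : 𝓞 L) ∉ v.asIdeal)
    (p n : ℕ) [ExpChar v.asIdeal.ResidueField p]
    {ψ : (R i).reduction ≅ (R o).reduction.frobeniusTwist p n}
    {e : (R c).reduction ≅ (R o).reduction.frobeniusTwist p n}
    {lam : A o ⟶ A i} (hlam : (H o i).redHom lam ≫ ψ.hom = (R o).reduction.relFrobenius p n)
    {θ : A i ⟶ A c} (hθ : (H i c).redHom θ = (ψ ≪≫ e.symm).hom) :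
    (H o c).redHom (lam ≫ θ) = (R o).reduction.relFrobenius p n ≫ e.inv := by
  rw [HomReduction.redHom_comp_of_isTateCompatible (hT o i) (hT i c) (hT o c) hℓv lam θ, hθ, Iso.trans_hom,
    Iso.symm_hom, ← Category.assoc, hlam]

end Family

/-! ### §3 (G-bc). Uniformisations along the tower `k₁ → L → ℂ` -/

namespace CMTypeUniformization

variable {K : Type} [Field K] [NumberField K] {Φ : CMType K} {𝔞 : (FractionalIdeal (𝓞 K)⁰ K)ˣ}
  {k₁ L : Type} [Field k₁] [Field L] [Algebra k₁ L] [Algebra L ℂ] [Algebra k₁ ℂ] [IsScalarTower k₁ L ℂ]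
  {A₁ : AbelianVariety k₁} {ι₁ : 𝓞 K →+* End A₁}

/-- **Moving a uniformised model up the tower `k₁ ⊆ L ⊂ ℂ`** ([Shimura1998] p0165 L15, condition (i): all the
`A_ν` rational over one field `L` containing their fields of definition): a uniformisation of type `(K, Φ, 𝔞)` of
`(A₁ ⊗_{k₁} ℂ, ι₁ ⊗ ℂ)` yields one of `((A₁ ⊗_{k₁} L) ⊗_L ℂ, (ι₁ ⊗ L) ⊗ ℂ)`, by transport (`ofIso`, §17.3 p. 117) along
the tower isomorphism `(A₁ ⊗_{k₁} L) ⊗_L ℂ ≅ A₁ ⊗_{k₁} ℂ` (the tree's `baseChangeTowerIso`, whose naturality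
`baseChangeTowerIso_inv_comp_baseChange_baseChange` is the required equivariance).
[cite: Shimura1998, §18.6 proof of Thm. 18.6, p. 128 (p0165 L15, condition (i)); §17.3 p. 117] -/
def baseChangeTower (ξ : CMTypeUniformization Φ 𝔞 (A₁.baseChange ℂ) ((endBaseChange ℂ A₁).comp ι₁)) :
    CMTypeUniformization Φ 𝔞 ((A₁.baseChange L).baseChange ℂ)
      ((endBaseChange ℂ (A₁.baseChange L)).comp ((endBaseChange L A₁).comp ι₁)) :=
  ξ.ofIso (baseChangeTowerIso k₁ L ℂ A₁).symm fun a => by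
    change Hom.baseChange ℂ (ι₁ a : A₁ ⟶ A₁) ≫ (baseChangeTowerIso k₁ L ℂ A₁).inv =
      (baseChangeTowerIso k₁ L ℂ A₁).inv ≫ Hom.baseChange ℂ (Hom.baseChange L (ι₁ a : A₁ ⟶ A₁))
    rw [baseChangeTowerIso_inv_comp_baseChange_baseChange]

/-- Shimura's `r = ξ ∘ q` of the moved model: `r′(u) = e⁻¹(r(u))` for the tower isomorphism `e` (`e.symm.hom = e⁻¹`).
[cite: Shimura1998, §18.6 Thm. 18.6 (2) p. 127; §17.3 p. 117] -/
theorem baseChangeTower_r (ξ : CMTypeUniformization Φ 𝔞 (A₁.baseChange ℂ) ((endBaseChange ℂ A₁).comp ι₁))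
    (u : K) :
    (ξ.baseChangeTower (L := L)).r u =
      AlgPoints.map (baseChangeTowerIso k₁ L ℂ A₁).symm.hom.hom.hom.hom (ξ.r u) :=
  ofIso_r _ _ _ _

end CMTypeUniformization

/-! ### §4 (G-κ, unbundled). `κ̃ ≫ e = π` for three varieties with pairwise reduction data -/

section Kappa

variable {L : Type} [Field L] [NumberField L] {A B C : AbelianVariety L} {v : HeightOneSpectrum (𝓞 L)}
  {RA : A.GoodReductionAt v} {RB : B.GoodReductionAt v} {RC : C.GoodReductionAt v}
  {HAB : HomReduction RA RB} {HBC : HomReduction RB RC} {HAC : HomReduction RA RC}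
  {ℓ : ℕ} [Fact ℓ.Prime] {TA : RA.TateSpecialisation ℓ} {TB : RB.TateSpecialisation ℓ} {TC : RC.TateSpecialisation ℓ}

/-- **`κ̃ ≫ e = π` for `κ := λ ≫ θ`, unbundled form** (three varieties `A`, `B = A_i`, `C = A^γ` with reduction data at
`v`, pair data `HAB`, `HBC`, `HAC` compatible with ONE system `(TA, TB, TC)` of `ℓ`-adic specialisations, `v ∤ ℓ` — the
binder shape of the named fact `HomReduction.exists_isTateCompatible_family_conj`, where `C`'s data are separate
binders): if `λ̃ ≫ ψ = π` ([Shimura1998] p0167 L11, `shimuraTaniyamaPair`) and `θ̃ = ψ ≫ e⁻¹` (the identification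
theorem), then `(λ ≫ θ)~ ≫ e = π` — the hypothesis «`κ̃ = π`» of the torsion step «`(t^σ)~ = π(t̃) = (κt)~`, hence
`t^σ = κt`» (p0168 L9; the tree's `conjPoints_eq_pointsMap_of_redHom_comp_eq`). Functoriality of the pair reductions
(`HomReduction.redHom_comp_of_isTateCompatible`, §11.1 Prop. 12/14 (i)).
[cite: Shimura1998, §18.6 proof of Thm. 18.6, p0168 L1–3 and L9; §11.1 Prop. 12 and Prop. 14 (i)] -/
theorem redHom_comp_comp_hom_eq_relFrobenius (hAB : HAB.IsTateCompatible TA TB) (hBC : HBC.IsTateCompatible TB TC)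
    (hAC : HAC.IsTateCompatible TA TC) (hℓv : (ℓ : 𝓞 L) ∉ v.asIdeal) (p n : ℕ) [ExpChar v.asIdeal.ResidueField p]
    {ψ : RB.reduction ≅ RA.reduction.frobeniusTwist p n} {e : RC.reduction ≅ RA.reduction.frobeniusTwist p n}
    {lam : A ⟶ B} (hlam : HAB.redHom lam ≫ ψ.hom = RA.reduction.relFrobenius p n)
    {θ : B ⟶ C} (hθ : HBC.redHom θ = (ψ ≪≫ e.symm).hom) :
    HAC.redHom (lam ≫ θ) ≫ e.hom = RA.reduction.relFrobenius p n := by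
  rw [HomReduction.redHom_comp_of_isTateCompatible hAB hBC hAC hℓv lam θ, hθ, Iso.trans_hom, Iso.symm_hom,
    Category.assoc, Category.assoc, Iso.inv_hom_id, Category.comp_id, hlam]

/-- The same, read as `κ̃ = π ≫ e⁻¹`. [cite: Shimura1998, §18.6 proof of Thm. 18.6, p0168 L1–3] -/
theorem redHom_comp_eq_relFrobenius_comp_inv' (hAB : HAB.IsTateCompatible TA TB) (hBC : HBC.IsTateCompatible TB TC)
    (hAC : HAC.IsTateCompatible TA TC) (hℓv : (ℓ : 𝓞 L) ∉ v.asIdeal) (p n : ℕ) [ExpChar v.asIdeal.ResidueField p]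
    {ψ : RB.reduction ≅ RA.reduction.frobeniusTwist p n} {e : RC.reduction ≅ RA.reduction.frobeniusTwist p n}
    {lam : A ⟶ B} (hlam : HAB.redHom lam ≫ ψ.hom = RA.reduction.relFrobenius p n)
    {θ : B ⟶ C} (hθ : HBC.redHom θ = (ψ ≪≫ e.symm).hom) :
    HAC.redHom (lam ≫ θ) = RA.reduction.relFrobenius p n ≫ e.inv := by
  rw [← redHom_comp_comp_hom_eq_relFrobenius hAB hBC hAC hℓv p n hlam hθ, Category.assoc, Iso.hom_inv_id,
    Category.comp_id]

end Kappa

end Literature.NumberTheory.ComplexMultiplication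

end
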